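import Summits.ABC.IUTFork.Conditional.WRowHexLamSevenTriplesEighteen
import Summits.ABC.IUTFork.Conditional.InhUniformBandCells
import Summits.ABC.IUTFork.Cor312LicenceTripleUnconditionalCeil
import HarnessLib

/-!
# R-W «OPEN-SINGLE-PRIMES» — the HEX family `λ_k = 1/2 + 2/7^k` at `k = 18`, the SINGLE LEVEL `l = 6917611`: the hull licence S_H HOLDS at EVERY
# genuine Θ-volume datum over `(ratPoint λ_18, 6917611)`, unconditionally — the inner-radius level of the `k = 18` axis, decided by the CEILING slot at `7`

PROOF-ONLY file (D-0012; 0 definitions, 0 `Prop` facts) of the abc-iut cell — D-0079 RESCUE sub-cell R-W «WINDOW Θ-SIDE INEQUALITY», seat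
abc-iut-W-neg-1 (gen 5), row «OPEN-SINGLE-PRIMES» (abc-iut-plan C-R105 (a) / C-R107 (a)(b): «k = 18 carries caveat level 6,917,611 @7»; abc-iut-C-cert-1 g9's
«W:HEX-AXIS-REST-2» names it for this seat). abc-iut-W-num-5's ENGINEC-CEIL-ONLY-LEVELS.tsv (a14426db4c9d93ee): at the tame pole `p = 7` of the Frey–Legendre
triple `1628413597910453 + 1628413597910445 = 3256827195820898` of `λ_18` (`7¹⁸ ∥ c`, `e = 5·l·n`) the top-label cell at `n = 1` (`e = 34588055`) FAILS under
the integer slot `⌊e/6⌋ = 5764675` and HOLDS under the CEILING `⌈e/6⌉ = 5764676`. THIS FILE discharges the arithmetic hypothesis of this seat's ceiling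
socket `WRow.licence_triple_unconditional_ceil` (`Cor312LicenceTripleUnconditionalCeil`, p512367; inner radius by `WRow.inner_witness_ceil`, p511165) at the
numeric level, in the shape of this seat's `WRowHexLamSevenTenLevel4723` (p513015), over abc-iut-C-cert-1's prelude `WRowHexLamSevenTriplesEighteen`
(`isABCTriple_hex18`, `lamSeven_eq_hex18`, `eq_of_prime_dvd_triple_hex18` with the Pratt certificate `prime_548472077437`, `factorization_triple_hex18`):
per bad prime `p ∈ {3, 5, 2969, 8070721, 13451203, 548472077437}` the integer-slot cells (`WRow.cell_wild_of_ends` / `WRow.cell_tameslot_of_ends`, two numeric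
end labels at `L = 3458805`) transport to the ceiling by `WRow.cell_of_le_rin` + `WRow.max_one_div_le_ceilSlot`; over `7` (`A_7 = 8`, `B_7 = 9`): `n ≥ 2`
floor-free from `n₀ = 2`, `n = 1` the level lemma `WRow.cell_hex18_p7_one_6917611` (interior labels by `InhBand.quad_nonpos_of_ends 90 (−311292369) (−276704405) · 6917609`,
the EXACT top-label cell incl. the floor by `norm_num`). DESK (this seat, work/deskN3.py, exact integers): chord ends, exact top cell and `n₀ = 2` ends hold;
the slot cell fails at the top label. TAKES NO SIDE on [IUTchIII] Cor. 3.12 (S. Mochizuki, *Inter-universal Teichmüller theory III*, Cor. 3.12 p. 173–174;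
Step (xi-f) p. 184) or on any author; «inhabited as typed» ≠ «asserted in print».

WHAT IS PROVED (namespace `Summit.ABC.IUTFork.Conditional`): `WRow.cell_hex18_p7_one_6917611`, `WRow.hcell_lamSeven_eighteen_ceil_6917611`,
**`WRow.licence_lamSeven_eighteen_level6917611 (hk : k = 18) (hl : l = 6917611) (T)`**, **`WRow.exists_qPinned_and_hull_lamSeven_eighteen_level6917611`**.
READING (neutral): the level is INHABITED AS TYPED; the two-sided bands of the `k = 18` axis are abc-iut-C-cert-1 g9's files, not claimed here.
Admissibility / (P6) / Szpiro-badness of `(ratPoint λ_18, l)` and NON-EMPTINESS of the datum type are NOT claimed. HONEST SCOPE: OUR sharp containers;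
STRONGER-THAN-PRINT hull reading; nothing about the printed inequality or any author's intended hull; typed ≠ proved; instantiated ≠ endorsed; no abc claim.
[cite: Mochizuki2012, IUTchI Def. 3.1 (b),(c) pp. 61–62, Rmk. 3.1.5 p. 65, Ex. 3.2 (iv) p. 71; IUTchIII Cor. 3.12 Step (xi-f) p. 184; IUTchIV Prop. 1.1 p. 9, Prop. 1.2 (i)(ii) p. 10, Prop. 1.4 (ii) p. 13, Cor. 2.2 (ii) proof (P5) p. 46]
[cite: DupuyHilado2025, §3.3, §3.4, §4.9, §4.12] [cite: NeukirchANT1999, Ch. II (5.5)–(5.7)] [claim: Mochizuki2012, status: disputed] for every IUT sentence.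
-/

noncomputable section

open Set Function Metric NumberField IsDedekindDomain

namespace Summit.ABC.IUTFork.Conditional

open Thm311 Thm311.Real Cor312 Cor312Vol Cor312Prov Literature.IUT.LogThetaLattice Literature.IUT.LogVolume
  Literature.IUT.HodgeTheaters Literature.IUT.LogVolume.Cor22
open Literature.NumberTheory.NumberFields Literature.NumberTheory.GaloisRepresentations.Ultrametric
open Literature.NumberTheory.DiophantineGeometry Literature.NumberTheory.DiophantineGeometry.GenEll

/-! ## The cell over `7` at `l = 6917611`, `n = 1` (`e = 34588055`), CEILING slot `⌈e/6⌉ = 5764676` -/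

/-- The socket's integer cell over `7` for the `λ_18` triple at the level `l = 6917611`, index `e = 5·l = 34588055` (`n = 1`), `P = 90`, `D = e − 1`,
inner radius the CEILING `⌈e/6⌉ = 5764676` (`6 ∤ e`), `ρout = min(7^8 − 8e, 7^9 − 9e) = −270939639`: floor-free and convex on the labels `j ≤ 3458804`
(`InhBand.quad_nonpos_of_ends 90 (−311292369) (−276704405) · 6917609`), and the EXACT integer cell, floor included, at the top label `j = 3458805`, where the floor-free
form fails; under the integer slot `5764675` that top cell fails (abc-iut-W-num-5's ENGINEC-CEIL-ONLY-LEVELS record). [folklore] -/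
theorem WRow.cell_hex18_p7_one_6917611 (i : ℕ) (hi : i < (6917611 - 1) / 2) :
    (((34588055 : ℕ)) : ℤ) * ((((i + 1 : ℕ) : ℤ) ^ 2 * (((90 : ℕ)) : ℤ) - ((i + 1 : ℕ) : ℤ) * ((((34588054 : ℕ)) : ℕ) : ℤ) -
        ((i + 2 : ℕ) : ℤ) * (((5764676 : ℕ)) : ℤ)) / (((34588055 : ℕ)) : ℤ)) +
      ((i + 2 : ℕ) : ℤ) * min (((7 : ℕ) : ℤ) ^ 8 - ((8 : ℕ) : ℤ) * (((34588055 : ℕ)) : ℤ)) (((7 : ℕ) : ℤ) ^ 9 - ((9 : ℕ) : ℤ) * (((34588055 : ℕ)) : ℤ)) ≤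
      (((90 : ℕ)) : ℤ) := by
  rcases Nat.lt_or_ge (i + 1) 3458805 with hlt | hge
  · have he0 : (0 : ℤ) < ((34588055 : ℕ) : ℤ) := by positivity
    have hfloor := Int.mul_ediv_self_le (k := ((34588055 : ℕ) : ℤ))
      (x := (((i + 1 : ℕ) : ℤ) ^ 2 * (((90 : ℕ)) : ℤ) - ((i + 1 : ℕ) : ℤ) * ((((34588054 : ℕ)) : ℕ) : ℤ) - ((i + 2 : ℕ) : ℤ) * (((5764676 : ℕ)) : ℤ))) he0.ne'
    have hmin : min (((7 : ℕ) : ℤ) ^ 8 - ((8 : ℕ) : ℤ) * (((34588055 : ℕ)) : ℤ)) (((7 : ℕ) : ℤ) ^ 9 - ((9 : ℕ) : ℤ) * (((34588055 : ℕ)) : ℤ)) = -270939639 := by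
      norm_num
    have hkl : 2 * ((i : ℤ) + 1) + 1 ≤ (6917609 : ℤ) := by
      have h1 : 2 * (i + 1) + 1 ≤ 6917609 := by omega
      exact_mod_cast h1
    have hquad := InhBand.quad_nonpos_of_ends 90 (-311292369) (-276704405) ((i : ℤ) + 1) 6917609 (by norm_num) (by norm_num) (by linarith) hkl
      (by norm_num) (by norm_num)
    rw [hmin]
    generalize hQ : ((((i + 1 : ℕ) : ℤ) ^ 2 * (((90 : ℕ)) : ℤ) - ((i + 1 : ℕ) : ℤ) * ((((34588054 : ℕ)) : ℕ) : ℤ) - ((i + 2 : ℕ) : ℤ) * (((5764676 : ℕ)) : ℤ))) /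
      (((34588055 : ℕ)) : ℤ) = Q at hfloor ⊢
    push_cast at hfloor hquad ⊢
    linarith [hfloor, hquad]
  · obtain rfl : i = 3458804 := by omega
    norm_num

/-! ## The arithmetic of the CEILING-slot socket at `l = 6917611` -/

/-- **The ceiling socket's arithmetic hypothesis `hcell` for `(1628413597910453, 1628413597910445, 3256827195820898)` at the level `l = 6917611`.** Per prime of `abc`
other than `2, l`: the divisibilities the socket hands over force `e = m_p·l·n` (`n ≥ 1`), `e` is off the cyclotomic indices, and with the exponents `A_7 = 8`, `B_7 = 9`,
`A = 0`, `B = 1` elsewhere the cells hold at every label `j ≤ 3458805`: over `3, 5` (wild) and `2969, 8070721, 13451203, 548472077437` (tame) the integer-slot cells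
(`WRow.cell_wild_of_ends` / `WRow.cell_tameslot_of_ends`, numeric ends) transported to the ceiling (`WRow.cell_of_le_rin`, `WRow.max_one_div_le_ceilSlot`); over `7`
(`e = 5·l·n`): `n ≥ 2` the same from `n₀ = 2`, `n = 1` by `WRow.cell_hex18_p7_one_6917611` (ceiling `5764676`, exact top-label cell). The primality of `548472077437`
is abc-iut-C-cert-1's Pratt certificate `prime_548472077437`, reached through `eq_of_prime_dvd_triple_hex18`. [folklore] -/
theorem WRow.hcell_lamSeven_eighteen_ceil_6917611 {l : ℕ} (hl6917611 : l = 6917611) :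
    ∀ p : ℕ, p.Prime → p ∣ 1628413597910453 * 1628413597910445 * 3256827195820898 → p ≠ 2 → p ≠ l → ∀ e : ℕ, 0 < e → l ∣ e →
      15 * l ∣ e * (1628413597910453 * 1628413597910445 * 3256827195820898).factorization p → (p ∣ 30 → (p - 1) ∣ e) →
      (p ∣ 3256827195820898 → Odd ((1628413597910453 * 1628413597910445 * 3256827195820898).factorization p) → 30 * l ∣ e * (1628413597910453 * 1628413597910445 * 3256827195820898).factorization p) →
      (∀ k : ℕ, (e : ℤ) ≠ (p : ℤ) ^ k * ((p : ℤ) - 1)) ∧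
      ∀ i : ℕ, i < (l - 1) / 2 →
        (e : ℤ) * ((((i + 1 : ℕ) : ℤ) ^ 2 * ((e * (2 * (1628413597910453 * 1628413597910445 * 3256827195820898).factorization p) / (2 * l) : ℕ) : ℤ) -
            ((i + 1 : ℕ) : ℤ) * (((if p ∣ 30 ∧ ¬ p ∣ (1628413597910453 * 1628413597910445 * 3256827195820898).factorization p then 2 * e - 1 else e - 1 : ℕ) : ℕ) : ℤ) -
            ((i + 2 : ℕ) : ℤ) * ((((e + (p - 2)) / (p - 1) : ℕ) : ℤ))) / (e : ℤ)) +
          ((i + 2 : ℕ) : ℤ) * min ((p : ℤ) ^ (if p = 7 then 8 else 0) - ((if p = 7 then 8 else 0 : ℕ) : ℤ) * (e : ℤ))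
            ((p : ℤ) ^ (if p = 7 then 9 else 1) - ((if p = 7 then 9 else 1 : ℕ) : ℤ) * (e : ℤ)) ≤
        ((e * (2 * (1628413597910453 * 1628413597910445 * 3256827195820898).factorization p) / (2 * l) : ℕ) : ℤ) := by
  subst hl6917611
  have hl : Nat.Prime 6917611 := by norm_num
  intro p hp hpabc h2 hpl e he _hle h15 h30 hodd
  rcases eq_of_prime_dvd_triple_hex18 hp hpabc with rfl | rfl | rfl | rfl | rfl | rfl | rfl | rfl
  · exact absurd rfl h2
  · -- `p = 3`: `v = 1`, wild `D = 2e − 1`, `e = 30·l·n`, `A = 0`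
    rw [factorization_triple_hex18.1] at h15 hodd ⊢
    have hA : 15 * 6917611 ∣ e := by simpa using h15
    have hq : 2 ∣ e := by have := h30 (by norm_num); norm_num at this; exact this
    have he0 : 30 * 6917611 ∣ e := by
      have := Nat.Coprime.mul_dvd_of_dvd_of_dvd (by norm_num : Nat.Coprime 2 (15 * 6917611)) hq hA
      rwa [← mul_assoc] at this
    obtain ⟨n, rfl⟩ := he0
    have hn : 1 ≤ n := Nat.pos_of_ne_zero (by rintro rfl; simp at he)
    refine ⟨WRow.natCast_ne_pow_mul_sub_one (by norm_num : Nat.Prime 5) (by norm_num) (by norm_num) (by norm_num)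
      ⟨6 * 6917611 * n, by ring⟩, fun i hi => ?_⟩
    refine WRow.cell_of_le_rin (by positivity) (show (((max 1 (30 * 6917611 * n / (3 - 1))) : ℕ) : ℤ) ≤ (((30 * 6917611 * n + (3 - 2)) / (3 - 1) : ℕ) : ℤ) from
      by exact_mod_cast WRow.max_one_div_le_ceilSlot (by norm_num) he) ?_
    have hmax : 1 ≤ 30 * 6917611 * n / (3 - 1) := (Nat.le_div_iff_mul_le (by norm_num)).mpr (by omega)
    rw [if_pos ⟨by norm_num, by norm_num⟩, max_eq_right hmax]
    simp only [show ((3 : ℕ) = 7) = False from eq_false (by decide), ite_false]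
    refine WRow.cell_wild_of_ends ((3 : ℕ) : ℤ) (30 * 6917611) (3 - 1) (2 * 1) (2 * 6917611) 0 1 ((6917611 - 1) / 2) (by norm_num) (by norm_num)
      (by norm_num) (by norm_num) (by norm_num) (by norm_num) ?_ hi hn
    rintro i (rfl | hi')
    · norm_num
    · obtain rfl : i = 3458804 := by omega
      norm_num
  · -- `p = 5`: `v = 1`, wild `D = 2e − 1`, `e = 60·l·n`, `A = 0`
    rw [factorization_triple_hex18.2.1] at h15 hodd ⊢
    have hA : 15 * 6917611 ∣ e := by simpa using h15
    have hq : 4 ∣ e := by have := h30 (by norm_num); norm_num at this; exact this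
    have he0 : 60 * 6917611 ∣ e := by
      have := Nat.Coprime.mul_dvd_of_dvd_of_dvd (by norm_num : Nat.Coprime 4 (15 * 6917611)) hq hA
      rwa [← mul_assoc] at this
    obtain ⟨n, rfl⟩ := he0
    have hn : 1 ≤ n := Nat.pos_of_ne_zero (by rintro rfl; simp at he)
    refine ⟨WRow.natCast_ne_pow_mul_sub_one (by norm_num : Nat.Prime 3) (by norm_num) (by norm_num) (by norm_num)
      ⟨20 * 6917611 * n, by ring⟩, fun i hi => ?_⟩
    refine WRow.cell_of_le_rin (by positivity) (show (((max 1 (60 * 6917611 * n / (5 - 1))) : ℕ) : ℤ) ≤ (((60 * 6917611 * n + (5 - 2)) / (5 - 1) : ℕ) : ℤ) from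
      by exact_mod_cast WRow.max_one_div_le_ceilSlot (by norm_num) he) ?_
    have hmax : 1 ≤ 60 * 6917611 * n / (5 - 1) := (Nat.le_div_iff_mul_le (by norm_num)).mpr (by omega)
    rw [if_pos ⟨by norm_num, by norm_num⟩, max_eq_right hmax]
    simp only [show ((5 : ℕ) = 7) = False from eq_false (by decide), ite_false]
    refine WRow.cell_wild_of_ends ((5 : ℕ) : ℤ) (60 * 6917611) (5 - 1) (2 * 1) (2 * 6917611) 0 1 ((6917611 - 1) / 2) (by norm_num) (by norm_num)
      (by norm_num) (by norm_num) (by norm_num) (by norm_num) ?_ hi hn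
    rintro i (rfl | hi')
    · norm_num
    · obtain rfl : i = 3458804 := by omega
      norm_num
  · -- `p = 7`: `v = 18`, tame, `e = 5·l·n`, `A = 8`, `B = 9`; the BINDING prime — CEILING slot
    rw [factorization_triple_hex18.2.2.1] at h15 hodd ⊢
    have h15' : 5 * 6917611 * 3 ∣ e * 6 * 3 := by
      rw [show 5 * 6917611 * 3 = 15 * 6917611 by norm_num, show e * 6 * 3 = e * 18 by ring]; exact h15
    have hA : 5 * 6917611 ∣ e :=
      (by norm_num : Nat.Coprime (5 * 6917611) 6).dvd_of_dvd_mul_right (Nat.dvd_of_mul_dvd_mul_right (by norm_num) h15')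
    obtain ⟨n, rfl⟩ := hA
    have hn : 1 ≤ n := Nat.pos_of_ne_zero (by rintro rfl; simp at he)
    refine ⟨WRow.natCast_ne_pow_mul_sub_one (by norm_num : Nat.Prime 5) (by norm_num) (by norm_num) (by norm_num)
      ⟨6917611 * n, by ring⟩, fun i hi => ?_⟩
    rw [if_neg (by norm_num : ¬ ((7 : ℕ) ∣ 30 ∧ ¬ (7 : ℕ) ∣ 18))]
    simp only [ite_true]
    rcases Nat.lt_or_ge n 2 with hn2 | hn2
    · -- `n = 1`: the level cell with the EXACT top label under the ceiling `5764676`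
      obtain rfl : n = 1 := by omega
      have hP : (5 * 6917611 * 1 * (2 * 18) / (2 * 6917611) : ℕ) = 90 := by norm_num
      have hD : (5 * 6917611 * 1 - 1 : ℕ) = 34588054 := by norm_num
      have hR : ((5 * 6917611 * 1 + (7 - 2)) / (7 - 1) : ℕ) = 5764676 := by norm_num
      have hE : (5 * 6917611 * 1 : ℕ) = 34588055 := by norm_num
      rw [hP, hD, hR, hE]
      exact WRow.cell_hex18_p7_one_6917611 i hi
    · -- `n ≥ 2`: integer-slot floor-free cells from `n₀ = 2`, transported to the ceiling
      refine WRow.cell_of_le_rin (by positivity) (show (((max 1 (5 * 6917611 * n / (7 - 1))) : ℕ) : ℤ) ≤ (((5 * 6917611 * n + (7 - 2)) / (7 - 1) : ℕ) : ℤ) from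
        by exact_mod_cast WRow.max_one_div_le_ceilSlot (by norm_num) he) ?_
      refine WRow.cell_tameslot_of_ends ((7 : ℕ) : ℤ) (5 * 6917611) (7 - 1) (5 * 6917611 / (7 - 1)) (2 * 18) (2 * 6917611) 8 9 ((6917611 - 1) / 2) 2 (by norm_num)
        (by norm_num) (Nat.div_mul_le_self _ _) (by norm_num) (by norm_num) (by norm_num) (by norm_num) ?_ hi hn2
      rintro i (rfl | hi')
      · norm_num
      · obtain rfl : i = 3458804 := by omega
        norm_num
  · -- `p = 2969`: `v = 1`, tame, `e = 15·l·n`, `A = 0`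
    rw [factorization_triple_hex18.2.2.2.1] at h15 hodd ⊢
    have hA : 15 * 6917611 ∣ e := by simpa using h15
    obtain ⟨n, rfl⟩ := hA
    have hn : 1 ≤ n := Nat.pos_of_ne_zero (by rintro rfl; simp at he)
    refine ⟨WRow.natCast_ne_pow_mul_sub_one (by norm_num : Nat.Prime 3) (by norm_num) (by norm_num) (by norm_num)
      ⟨5 * 6917611 * n, by ring⟩, fun i hi => ?_⟩
    refine WRow.cell_of_le_rin (by positivity) (show (((max 1 (15 * 6917611 * n / (2969 - 1))) : ℕ) : ℤ) ≤ (((15 * 6917611 * n + (2969 - 2)) / (2969 - 1) : ℕ) : ℤ) from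
      by exact_mod_cast WRow.max_one_div_le_ceilSlot (by norm_num) he) ?_
    rw [if_neg (by norm_num : ¬ ((2969 : ℕ) ∣ 30 ∧ ¬ (2969 : ℕ) ∣ 1))]
    simp only [show ((2969 : ℕ) = 7) = False from eq_false (by decide), ite_false]
    refine WRow.cell_tameslot_of_ends ((2969 : ℕ) : ℤ) (15 * 6917611) (2969 - 1) (15 * 6917611 / (2969 - 1)) (2 * 1) (2 * 6917611) 0 1 ((6917611 - 1) / 2) 1 (by norm_num)
      (by norm_num) (Nat.div_mul_le_self _ _) (by norm_num) (by norm_num) (by norm_num) le_rfl ?_ hi hn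
    rintro i (rfl | hi')
    · norm_num
    · obtain rfl : i = 3458804 := by omega
      norm_num
  · -- `p = 8070721`: `v = 1`, tame, `e = 15·l·n`, `A = 0`
    rw [factorization_triple_hex18.2.2.2.2.1] at h15 hodd ⊢
    have hA : 15 * 6917611 ∣ e := by simpa using h15
    obtain ⟨n, rfl⟩ := hA
    have hn : 1 ≤ n := Nat.pos_of_ne_zero (by rintro rfl; simp at he)
    refine ⟨WRow.natCast_ne_pow_mul_sub_one hl (by norm_num : Nat.Prime 8070721) (by norm_num) (by norm_num) ⟨15 * n, by ring⟩, fun i hi => ?_⟩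
    refine WRow.cell_of_le_rin (by positivity) (show (((max 1 (15 * 6917611 * n / (8070721 - 1))) : ℕ) : ℤ) ≤ (((15 * 6917611 * n + (8070721 - 2)) / (8070721 - 1) : ℕ) : ℤ) from
      by exact_mod_cast WRow.max_one_div_le_ceilSlot (by norm_num) he) ?_
    rw [if_neg (by norm_num : ¬ ((8070721 : ℕ) ∣ 30 ∧ ¬ (8070721 : ℕ) ∣ 1))]
    simp only [show ((8070721 : ℕ) = 7) = False from eq_false (by decide), ite_false]
    refine WRow.cell_tameslot_of_ends ((8070721 : ℕ) : ℤ) (15 * 6917611) (8070721 - 1) (15 * 6917611 / (8070721 - 1)) (2 * 1) (2 * 6917611) 0 1 ((6917611 - 1) / 2) 1 (by norm_num)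
      (by norm_num) (Nat.div_mul_le_self _ _) (by norm_num) (by norm_num) (by norm_num) le_rfl ?_ hi hn
    rintro i (rfl | hi')
    · norm_num
    · obtain rfl : i = 3458804 := by omega
      norm_num
  · -- `p = 13451203`: `v = 1`, tame, `e = 15·l·n`, `A = 0`
    rw [factorization_triple_hex18.2.2.2.2.2.1] at h15 hodd ⊢
    have hA : 15 * 6917611 ∣ e := by simpa using h15
    obtain ⟨n, rfl⟩ := hA
    have hn : 1 ≤ n := Nat.pos_of_ne_zero (by rintro rfl; simp at he)
    refine ⟨WRow.natCast_ne_pow_mul_sub_one (by norm_num : Nat.Prime 5) (by norm_num) (by norm_num) (by norm_num)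
      ⟨3 * 6917611 * n, by ring⟩, fun i hi => ?_⟩
    refine WRow.cell_of_le_rin (by positivity) (show (((max 1 (15 * 6917611 * n / (13451203 - 1))) : ℕ) : ℤ) ≤ (((15 * 6917611 * n + (13451203 - 2)) / (13451203 - 1) : ℕ) : ℤ) from
      by exact_mod_cast WRow.max_one_div_le_ceilSlot (by norm_num) he) ?_
    rw [if_neg (by norm_num : ¬ ((13451203 : ℕ) ∣ 30 ∧ ¬ (13451203 : ℕ) ∣ 1))]
    simp only [show ((13451203 : ℕ) = 7) = False from eq_false (by decide), ite_false]
    refine WRow.cell_tameslot_of_ends ((13451203 : ℕ) : ℤ) (15 * 6917611) (13451203 - 1) (15 * 6917611 / (13451203 - 1)) (2 * 1) (2 * 6917611) 0 1 ((6917611 - 1) / 2) 1 (by norm_num)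
      (by norm_num) (Nat.div_mul_le_self _ _) (by norm_num) (by norm_num) (by norm_num) le_rfl ?_ hi hn
    rintro i (rfl | hi')
    · norm_num
    · obtain rfl : i = 3458804 := by omega
      norm_num
  · -- `p = 548472077437`: `v = 1`, tame, `e = 15·l·n`, `A = 0`
    rw [factorization_triple_hex18.2.2.2.2.2.2] at h15 hodd ⊢
    have hA : 15 * 6917611 ∣ e := by simpa using h15
    obtain ⟨n, rfl⟩ := hA
    have hn : 1 ≤ n := Nat.pos_of_ne_zero (by rintro rfl; simp at he)
    refine ⟨WRow.natCast_ne_pow_mul_sub_one (by norm_num : Nat.Prime 5) hp (by norm_num) (by norm_num)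
      ⟨3 * 6917611 * n, by ring⟩, fun i hi => ?_⟩
    refine WRow.cell_of_le_rin (by positivity) (show (((max 1 (15 * 6917611 * n / (548472077437 - 1))) : ℕ) : ℤ) ≤ (((15 * 6917611 * n + (548472077437 - 2)) / (548472077437 - 1) : ℕ) : ℤ) from
      by exact_mod_cast WRow.max_one_div_le_ceilSlot (by norm_num) he) ?_
    rw [if_neg (by norm_num : ¬ ((548472077437 : ℕ) ∣ 30 ∧ ¬ (548472077437 : ℕ) ∣ 1))]
    simp only [show ((548472077437 : ℕ) = 7) = False from eq_false (by decide), ite_false]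
    refine WRow.cell_tameslot_of_ends ((548472077437 : ℕ) : ℤ) (15 * 6917611) (548472077437 - 1) (15 * 6917611 / (548472077437 - 1)) (2 * 1) (2 * 6917611) 0 1 ((6917611 - 1) / 2) 1 (by norm_num)
      (by norm_num) (Nat.div_mul_le_self _ _) (by norm_num) (by norm_num) (by norm_num) le_rfl ?_ hi hn
    rintro i (rfl | hi')
    · norm_num
    · obtain rfl : i = 3458804 := by omega
      norm_num

/-! ## THE LEVEL: S_H INHABITED at every genuine datum over `(ratPoint λ_18, 6917611)`, `λ_18 = 1/2 + 2/7¹⁸` -/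

/-- **«OPEN-SINGLE-PRIMES», HEX `k = 18` at the level `l = 6917611`**: every genuine Θ-volume datum `T` at `(ratPoint (1/2 + 2/7^18), 6917611)`
([IUTchIV] Cor. 2.2 (ii) proof (P7); abc-iut-w5-d044's HEX family) and every pair of Θ- and q-ideles realising the pilot divisors of `X := pilotDataOfK T.D T.K`, abc-iut-c312-1's
`Thm311ToCor312.Licence` HOLDS at abc-iut-c312-7's `settingPrVolSharp X …` — this seat's CEILING-slot socket `WRow.licence_triple_unconditional_ceil` at `WRow.hcell_lamSeven_eighteen_ceil_6917611`,
transported along abc-iut-C-cert-1's `lamSeven_eq_hex18`. (abc-iut-W-num-5's ENGINEC-CEIL-ONLY-LEVELS: the one inner-radius level of the `k = 18` axis; the two-sided bands are C-cert-1 g9's «W:HEX-AXIS-REST-2».)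
[cite: Mochizuki2012, IUTchI Def. 3.1 (b),(c) pp. 61–62, Rmk. 3.1.5 p. 65, Ex. 3.2 (iv) p. 71; IUTchIII Cor. 3.12 Step (xi-f) p. 184; IUTchIV Prop. 1.1 p. 9, Prop. 1.2 (i)(ii) p. 10, Prop. 1.4 (ii) p. 13, Cor. 2.2 (ii) proof (P5) p. 46] [cite: DupuyHilado2025, §3.3, §3.4, §4.9, §4.12] [claim: Mochizuki2012, status: disputed] -/
theorem WRow.licence_lamSeven_eighteen_level6917611 {k l : ℕ} (hk : k = 18) (hl : l = 6917611) (T : Cor22.ThetaVolumeDatumAt (ratPoint ((2 : ℚ)⁻¹ + 2 / 7 ^ k)) l) :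
    letI := T.instFieldF; letI := T.instNumberFieldF; letI := T.instAlgebraF; letI := T.instFieldK
    letI := T.instNumberFieldK; letI := T.instAlgebraK; letI := T.instFieldFbar; letI := T.instAlgebraFbar
    letI := T.instAlgebraKFbar; letI := T.instIsElliptic
    ∀ {logv : PadicLogs T.K} (hlog : LogvAnalytic logv) (M : Type) [Field M] [NumberField M]
      (archPk : ∀ (j : (thetaIndex (pilotDataOfK T.D T.K)).Label) (vQ : (thetaIndex (pilotDataOfK T.D T.K)).VQ),
        Set ((logShellsDH (pilotDataOfK T.D T.K) logv).Packet j vQ))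
      (archSub : ∀ (j : (thetaIndex (pilotDataOfK T.D T.K)).Label) (v : (thetaIndex (pilotDataOfK T.D T.K)).V),
        Set ((logShellsDH (pilotDataOfK T.D T.K) logv).Packet j ((thetaIndex (pilotDataOfK T.D T.K)).over v)))
      (Ψ : ℤ → ∀ v : (thetaIndex (pilotDataOfK T.D T.K)).V, v ∈ (thetaIndex (pilotDataOfK T.D T.K)).Vbad →
        Set ((logShellsDH (pilotDataOfK T.D T.K) logv).StarPacket v))
      (act : ℤ → ∀ v : (thetaIndex (pilotDataOfK T.D T.K)).V, v ∈ (thetaIndex (pilotDataOfK T.D T.K)).Vbad →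
        (logShellsDH (pilotDataOfK T.D T.K) logv).StarPacket v → Module.End ℚ ((logShellsDH (pilotDataOfK T.D T.K) logv).StarPacket v))
      (Mmod : ℤ → ∀ j : (thetaIndex (pilotDataOfK T.D T.K)).LabelStar, Set ((logShellsDH (pilotDataOfK T.D T.K) logv).GlobalPacket j.1))
      (region : ℤ → ∀ j : (thetaIndex (pilotDataOfK T.D T.K)).LabelStar, FinDivisor M → ∀ vQ : (thetaIndex (pilotDataOfK T.D T.K)).VQ,
        Set ((logShellsDH (pilotDataOfK T.D T.K) logv).Packet j.1 vQ))
      (n : ℤ) {HT : Type} {LogLink : HT → HT → Type} {IsFull : ∀ {s t : HT}, LogLink s t → Prop}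
      (lat : LGPGaussianLogThetaLattice LogLink IsFull)
      {Frd : Type} {IsoF : Frd → Frd → Type} {Ob : Frd → Type} {realify : Frd → Frd} {Strip : Type}
      {IsoS : Strip → Strip → Type} {Mv : ∀ v : (thetaIndex (pilotDataOfK T.D T.K)).V, v ∈ (thetaIndex (pilotDataOfK T.D T.K)).Vbad → Type}
      [∀ v h, Monoid (Mv v h)]
      (sig : GlobalLGPFrobenioidSignature (thetaIndex (pilotDataOfK T.D T.K)).lstar (thetaIndex (pilotDataOfK T.D T.K)).V
        (· ∈ (thetaIndex (pilotDataOfK T.D T.K)).Vbad) Frd IsoF Ob realify Strip IsoS Mv)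
      (split : SplittingMonoids Mv) {ObΔ : Type} {N : ∀ v : (thetaIndex (pilotDataOfK T.D T.K)).V, v ∈ (thetaIndex (pilotDataOfK T.D T.K)).Vbad → Type}
      [∀ v h, Monoid (N v h)] (qData : QPilotData ObΔ N)
      (tq : ∀ (pp : Nat.Primes) (x : (thetaIndex (pilotDataOfK T.D T.K)).Fibre (.inr pp)),
        haveI : Fact (pp : ℕ).Prime := ⟨pp.2⟩; kOf (pilotDataOfK T.D T.K) pp.1 x)
      (t : ∀ (pp : Nat.Primes) (_ : Fin (pilotDataOfK T.D T.K).lstar) (x : (thetaIndex (pilotDataOfK T.D T.K)).Fibre (.inr pp)),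
        haveI : Fact (pp : ℕ).Prime := ⟨pp.2⟩; kOf (pilotDataOfK T.D T.K) pp.1 x)
      (htq0 : ∀ pp x, tq pp x ≠ 0)
      (htq1 : ∀ (pp : Nat.Primes) (x : (thetaIndex (pilotDataOfK T.D T.K)).Fibre (.inr pp)),
        haveI : Fact (pp : ℕ).Prime := ⟨pp.2⟩; placeOf (pilotDataOfK T.D T.K) pp.1 x ∉ (pilotDataOfK T.D T.K).S → ‖tq pp x‖ = 1)
      (_ht0 : ∀ pp i x, t pp i x ≠ 0)
      (_ht : ∀ (pp : Nat.Primes) (i : Fin (pilotDataOfK T.D T.K).lstar) (x : (thetaIndex (pilotDataOfK T.D T.K)).Fibre (.inr pp)),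
        haveI : Fact (pp : ℕ).Prime := ⟨pp.2⟩
        Real.log ‖t pp i x‖ = -((pilotDataOfK T.D T.K).thetaPilot i (placeOf (pilotDataOfK T.D T.K) pp.1 x)) *
          logNorm T.K (placeOf (pilotDataOfK T.D T.K) pp.1 x) / localDegree T.K (placeOf (pilotDataOfK T.D T.K) pp.1 x))
      (_htq : ∀ (pp : Nat.Primes) (x : (thetaIndex (pilotDataOfK T.D T.K)).Fibre (.inr pp)),
        haveI : Fact (pp : ℕ).Prime := ⟨pp.2⟩
        Real.log ‖tq pp x‖ = -((pilotDataOfK T.D T.K).qPilot (placeOf (pilotDataOfK T.D T.K) pp.1 x)) *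
          logNorm T.K (placeOf (pilotDataOfK T.D T.K) pp.1 x) / localDegree T.K (placeOf (pilotDataOfK T.D T.K) pp.1 x)),
      Thm311ToCor312.Licence
        (settingPrVolSharp (pilotDataOfK T.D T.K) hlog M archPk archSub Ψ act Mmod region n lat sig split qData tq t htq0 htq1) := by
  subst hk
  revert T
  rw [lamSeven_eq_hex18]
  intro T
  exact WRow.licence_triple_unconditional_ceil isABCTriple_hex18 (by rw [Cor22.jInv_ratPoint_triple isABCTriple_hex18]; norm_num) T
    (fun p => if p = 7 then 8 else 0) (fun p => if p = 7 then 9 else 1) (WRow.hcell_lamSeven_eighteen_ceil_6917611 hl)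

/-- **BRANCH C's PER-DATUM ANTECEDENT «∃ ρ qK, QPinned ∧ PilotKummerCompatHull» at every genuine datum over `(ratPoint (1/2 + 2/7^18), 6917611)`** (any columns
`col`; every pair of realising Θ- and q-ideles, the CHOSEN ones of the window certificates' `hSHw`/`hSHwBad` binders included): the per-datum S_H object of the
certificates of record (p453137 / p450130 / p447945) HOLDS at this datum class, UNCONDITIONALLY, under the CEILING inner slot.
[cite: Mochizuki2012, IUTchIII Cor. 3.12 Step (xi-d) p. 183, (xi-f) p. 184] [cite: DupuyHilado2025, §3.3, §3.4, §4.9] [claim: Mochizuki2012, status: disputed] -/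
theorem WRow.exists_qPinned_and_hull_lamSeven_eighteen_level6917611 {k l : ℕ} (hk : k = 18) (hl : l = 6917611) (T : Cor22.ThetaVolumeDatumAt (ratPoint ((2 : ℚ)⁻¹ + 2 / 7 ^ k)) l) :
    letI := T.instFieldF; letI := T.instNumberFieldF; letI := T.instAlgebraF; letI := T.instFieldK
    letI := T.instNumberFieldK; letI := T.instAlgebraK; letI := T.instFieldFbar; letI := T.instAlgebraFbar
    letI := T.instAlgebraKFbar; letI := T.instIsElliptic
    ∀ {logv : PadicLogs T.K} (hlog : LogvAnalytic logv) (M : Type) [Field M] [NumberField M]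
      (archPk : ∀ (j : (thetaIndex (pilotDataOfK T.D T.K)).Label) (vQ : (thetaIndex (pilotDataOfK T.D T.K)).VQ),
        Set ((logShellsDH (pilotDataOfK T.D T.K) logv).Packet j vQ))
      (archSub : ∀ (j : (thetaIndex (pilotDataOfK T.D T.K)).Label) (v : (thetaIndex (pilotDataOfK T.D T.K)).V),
        Set ((logShellsDH (pilotDataOfK T.D T.K) logv).Packet j ((thetaIndex (pilotDataOfK T.D T.K)).over v)))
      (Ψ : ℤ → ∀ v : (thetaIndex (pilotDataOfK T.D T.K)).V, v ∈ (thetaIndex (pilotDataOfK T.D T.K)).Vbad →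
        Set ((logShellsDH (pilotDataOfK T.D T.K) logv).StarPacket v))
      (act : ℤ → ∀ v : (thetaIndex (pilotDataOfK T.D T.K)).V, v ∈ (thetaIndex (pilotDataOfK T.D T.K)).Vbad →
        (logShellsDH (pilotDataOfK T.D T.K) logv).StarPacket v → Module.End ℚ ((logShellsDH (pilotDataOfK T.D T.K) logv).StarPacket v))
      (Mmod : ℤ → ∀ j : (thetaIndex (pilotDataOfK T.D T.K)).LabelStar, Set ((logShellsDH (pilotDataOfK T.D T.K) logv).GlobalPacket j.1))
      (region : ℤ → ∀ j : (thetaIndex (pilotDataOfK T.D T.K)).LabelStar, FinDivisor M → ∀ vQ : (thetaIndex (pilotDataOfK T.D T.K)).VQ,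
        Set ((logShellsDH (pilotDataOfK T.D T.K) logv).Packet j.1 vQ))
      (n : ℤ) {HT : Type} {LogLink : HT → HT → Type} {IsFull : ∀ {s t : HT}, LogLink s t → Prop}
      (lat : LGPGaussianLogThetaLattice LogLink IsFull)
      {Frd : Type} {IsoF : Frd → Frd → Type} {Ob : Frd → Type} {realify : Frd → Frd} {Strip : Type}
      {IsoS : Strip → Strip → Type} {Mv : ∀ v : (thetaIndex (pilotDataOfK T.D T.K)).V, v ∈ (thetaIndex (pilotDataOfK T.D T.K)).Vbad → Type}
      [∀ v h, Monoid (Mv v h)]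
      (sig : GlobalLGPFrobenioidSignature (thetaIndex (pilotDataOfK T.D T.K)).lstar (thetaIndex (pilotDataOfK T.D T.K)).V
        (· ∈ (thetaIndex (pilotDataOfK T.D T.K)).Vbad) Frd IsoF Ob realify Strip IsoS Mv)
      (split : SplittingMonoids Mv) {ObΔ : Type} {N : ∀ v : (thetaIndex (pilotDataOfK T.D T.K)).V, v ∈ (thetaIndex (pilotDataOfK T.D T.K)).Vbad → Type}
      [∀ v h, Monoid (N v h)] (qData : QPilotData ObΔ N)
      (tq : ∀ (pp : Nat.Primes) (x : (thetaIndex (pilotDataOfK T.D T.K)).Fibre (.inr pp)),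
        haveI : Fact (pp : ℕ).Prime := ⟨pp.2⟩; kOf (pilotDataOfK T.D T.K) pp.1 x)
      (t : ∀ (pp : Nat.Primes) (_ : Fin (pilotDataOfK T.D T.K).lstar) (x : (thetaIndex (pilotDataOfK T.D T.K)).Fibre (.inr pp)),
        haveI : Fact (pp : ℕ).Prime := ⟨pp.2⟩; kOf (pilotDataOfK T.D T.K) pp.1 x)
      (htq0 : ∀ pp x, tq pp x ≠ 0)
      (htq1 : ∀ (pp : Nat.Primes) (x : (thetaIndex (pilotDataOfK T.D T.K)).Fibre (.inr pp)),
        haveI : Fact (pp : ℕ).Prime := ⟨pp.2⟩; placeOf (pilotDataOfK T.D T.K) pp.1 x ∉ (pilotDataOfK T.D T.K).S → ‖tq pp x‖ = 1)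
      (col : ℤ → Column (logShellsDH (pilotDataOfK T.D T.K) logv))
      (_ht0 : ∀ pp i x, t pp i x ≠ 0)
      (_ht : ∀ (pp : Nat.Primes) (i : Fin (pilotDataOfK T.D T.K).lstar) (x : (thetaIndex (pilotDataOfK T.D T.K)).Fibre (.inr pp)),
        haveI : Fact (pp : ℕ).Prime := ⟨pp.2⟩
        Real.log ‖t pp i x‖ = -((pilotDataOfK T.D T.K).thetaPilot i (placeOf (pilotDataOfK T.D T.K) pp.1 x)) *
          logNorm T.K (placeOf (pilotDataOfK T.D T.K) pp.1 x) / localDegree T.K (placeOf (pilotDataOfK T.D T.K) pp.1 x))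
      (_htq : ∀ (pp : Nat.Primes) (x : (thetaIndex (pilotDataOfK T.D T.K)).Fibre (.inr pp)),
        haveI : Fact (pp : ℕ).Prime := ⟨pp.2⟩
        Real.log ‖tq pp x‖ = -((pilotDataOfK T.D T.K).qPilot (placeOf (pilotDataOfK T.D T.K) pp.1 x)) *
          logNorm T.K (placeOf (pilotDataOfK T.D T.K) pp.1 x) / localDegree T.K (placeOf (pilotDataOfK T.D T.K) pp.1 x)),
      ∃ (ρ : (∀ v : (thetaIndex (pilotDataOfK T.D T.K)).V, v ∈ (thetaIndex (pilotDataOfK T.D T.K)).Vbad →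
              Set ((logShellsDH (pilotDataOfK T.D T.K) logv).StarPacket v)) →
            ∀ (j : (thetaIndex (pilotDataOfK T.D T.K)).Label) (vQ : (thetaIndex (pilotDataOfK T.D T.K)).VQ),
              Set ((logShellsDH (pilotDataOfK T.D T.K) logv).Packet j vQ))
          (qK : ∀ v : (thetaIndex (pilotDataOfK T.D T.K)).V, v ∈ (thetaIndex (pilotDataOfK T.D T.K)).Vbad →
            Set ((logShellsDH (pilotDataOfK T.D T.K) logv).StarPacket v)),
          QPinned ({ toSituation := situationPrVol (pilotDataOfK T.D T.K) hlog M archPk archSub Ψ act Mmod region, col := col } :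
              LatticeSituation (thetaIndex (pilotDataOfK T.D T.K)))
            (settingPrVolSharp (pilotDataOfK T.D T.K) hlog M archPk archSub Ψ act Mmod region n lat sig split qData tq t htq0 htq1) ρ qK ∧
          PilotKummerCompatHull ({ toSituation := situationPrVol (pilotDataOfK T.D T.K) hlog M archPk archSub Ψ act Mmod region, col := col } :
              LatticeSituation (thetaIndex (pilotDataOfK T.D T.K)))
            (settingPrVolSharp (pilotDataOfK T.D T.K) hlog M archPk archSub Ψ act Mmod region n lat sig split qData tq t htq0 htq1) ρ qK := by
  subst hk
  revert T
  rw [lamSeven_eq_hex18]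
  intro T
  exact WRow.exists_qPinned_and_hull_triple_unconditional_ceil isABCTriple_hex18 (by rw [Cor22.jInv_ratPoint_triple isABCTriple_hex18]; norm_num) T
    (fun p => if p = 7 then 8 else 0) (fun p => if p = 7 then 9 else 1) (WRow.hcell_lamSeven_eighteen_ceil_6917611 hl)

end Summit.ABC.IUTFork.Conditional

end
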